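import Summits.CriticalPhenomena.PercolationContinuityZ3.Theorems.PercNearOneGluingNoHeavyLowerTailSingletonPocketPackingAux
import HarnessLib

/-!
# `NoHeavyLowerTail` (stmt-CriticalPhenomena-4575) — the SINGLETON-POCKET PACKING inequality:
# a lonely observer pocket cannot coexist with a heavy champion more often than the observer is heavy

Support file (coupling seat `prim-cplus-coupling`, gen 2; `--supports stmt-CriticalPhenomena-4575`).  No definitions,
no named facts, no sorries.

Bond percolation `μ = prodBernoulli w` on `Fin n`, relays `A`, level `j ≥ 1`, observer `o ∉ A`,
`π(v) = {z ∈ A : v ↔ z}` (the Finset `A.filter (fun z => ω ∈ openConn v z)`), `N = |π(o)|`.  A CHAMPION is a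
relay `c ∈ A` with `μ(|π(a)| ≤ j) ≤ μ(|π(c)| ≤ j)` for every `a ∈ A`.

**Theorem (`singletonPocket_le_heavy`).**  If every two relays are separable with positive probability, then for
a champion `c`

  `μ(N = 1, |π(c)| > j) ≤ μ(N > j, o ↮ c)`.

For `|A| = 2` (hub form) this is Kozma–Nitzan's Theorem 1; for general `A` it is new in the tree: it is the
`N = 1` layer of the sharp cumulative-isolation inequality `μ(1 ≤ N ≤ j, |π(c)| > j) ≤ μ(N > j, o ↮ c)` of the
`|A| = 5` rung, PACKED (constant `1`, not `|A| − 1`): the two-cluster transfer alone gives it only summed with the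
multiplicity `N` on the right.

Proof (van den Berg–Häggström–Kahn for set sources + Kozma–Nitzan's Lemma 2, all landed):
1. `{N = 1, c heavy} ⊆ ⋃_{t ≠ c} {t isolated} ∩ {t ↔ o} ∩ {c heavy}`, and by BHK Thm 1.4 for the sources `{t}`,
   `A ∖ t` (`stub_bhkSets.2`): `μ(t isolated, t ↔ o, c heavy) ≤ ψ_t · μ(t isolated, c heavy)`,
   `ψ_t = μ(t ↔ o | t isolated)`;
2. `μ(t isolated, c heavy) ≤ μ(c ↮ t, c heavy) ≤ μ(c ↮ t, t heavy)` — the champion hypothesis, the two lightness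
   events agreeing on `{c ↔ t}` — and `{c ↮ t, t heavy} ⊆ ⋃_{T ∌ c heavy, T ∋ t} {T is a block}`;
3. swapping the sums, for each heavy `T ∌ c`: `Σ_{t ∈ T} ψ_t ≤ φ_T = μ(T ↔ o | T ↮ A ∖ T)` (KN Lemma 2, `knK_lemma2`)
   and `φ_T · μ(T is a block) ≤ μ(T is a block, T ↔ o)` (BHK Thm 1.3 for the source set `T`, `stub_bhkSets.1`);
4. the events `{T is a block, T ↔ o}`, `T ∌ c` heavy, are disjoint and lie in `{N > j, o ↮ c}`.
[cite: KozmaNitzan2024, Lemma 2 p. 6, Theorem 1 p. 7; VandenbergHaggstromKahn2005, Thms. 1.3–1.4]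
-/

noncomputable section

namespace Summit.CriticalPhenomena.PercolationContinuityZ3.Theorems

open MeasureTheory Set Literature.Probability.LatticeModels Literature.Probability.Percolation
open scoped Classical BigOperators

namespace SingletonPocketPacking

variable {n : ℕ}

/-! ### The packing step and the per-relay bound -/

/-- **Step 3 (packing).**  For `T ⊆ A` whose relays are simultaneously separable from all other relays with positive
probability: `(Σ_{t ∈ T} ψ_t) · μ(T is a block) ≤ μ(T is a block, T ↔ o)`, `ψ_t = μ(t ↔ o | t isolated)` — Kozma–Nitzan's
Lemma 2 (`knK_lemma2`) followed by BHK Thm 1.3 for the source set `T` (`block_conn`).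
[cite: KozmaNitzan2024, Lemma 2 p. 6; VandenbergHaggstromKahn2005, Thm. 1.3] -/
theorem packing (w : Sym2 (Fin n) → unitInterval) (A T : Finset (Fin n)) (o : Fin n) (hTA : T ⊆ A)
    (hMT : 0 < (prodBernoulli w).real {ω : BondConfig (Fin n) | ∀ k ∈ T, ∀ l ∈ A, k ≠ l → ¬ (openGraph ω).Reachable k l}) :
    (∑ i ∈ T, (prodBernoulli w).real ({ω : BondConfig (Fin n) | ∀ x ∈ A.erase i, ¬ (openGraph ω).Reachable i x} ∩ openConn i o) /
        (prodBernoulli w).real {ω : BondConfig (Fin n) | ∀ x ∈ A.erase i, ¬ (openGraph ω).Reachable i x}) *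
      (prodBernoulli w).real {ω : BondConfig (Fin n) | ∀ s ∈ T, (A.filter fun z => ω ∈ openConn s z) = T} ≤
    (prodBernoulli w).real ({ω : BondConfig (Fin n) | ∀ s ∈ T, (A.filter fun z => ω ∈ openConn s z) = T} ∩
      ⋃ s ∈ T, (openConn s o : Set (BondConfig (Fin n)))) := by
  have L2 := knK_lemma2 w o A T hTA hMT
  have B := block_conn w A T o
  rw [block_eq A T hTA]
  set μ := prodBernoulli w with hμ
  set DT : Set (BondConfig (Fin n)) :=
    {ω : BondConfig (Fin n) | ∀ s ∈ T, ∀ x ∈ (↑(A \ T) : Set (Fin n)), ¬ (openGraph ω).Reachable s x} with hDT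
  set IT : Set (BondConfig (Fin n)) := {ω : BondConfig (Fin n) | ∀ s ∈ T, ∀ s' ∈ T, ω ∈ openConn s s'} with hIT
  set CoT : Set (BondConfig (Fin n)) := ⋃ s ∈ T, (openConn s o : Set (BondConfig (Fin n))) with hCoT
  set Ψ : ℝ := ∑ i ∈ T, μ.real ({ω : BondConfig (Fin n) | ∀ x ∈ A.erase i, ¬ (openGraph ω).Reachable i x} ∩ openConn i o) /
        μ.real {ω : BondConfig (Fin n) | ∀ x ∈ A.erase i, ¬ (openGraph ω).Reachable i x} with hΨ
  have hset : DT ∩ IT ∩ CoT = DT ∩ (CoT ∩ IT) := by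
    rw [Set.inter_assoc, Set.inter_comm IT CoT]
  rw [hset]
  by_cases hD0 : μ.real DT = 0
  · have h0 : μ.real (DT ∩ IT) = 0 :=
      le_antisymm (le_trans (measureReal_mono Set.inter_subset_left (measure_ne_top _ _)) (le_of_eq hD0)) measureReal_nonneg
    rw [h0, mul_zero]
    exact measureReal_nonneg
  · have hDpos : 0 < μ.real DT := lt_of_le_of_ne measureReal_nonneg (Ne.symm hD0)
    calc Ψ * μ.real (DT ∩ IT) ≤ μ.real (DT ∩ CoT) / μ.real DT * μ.real (DT ∩ IT) :=
          mul_le_mul_of_nonneg_right L2 measureReal_nonneg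
      _ ≤ μ.real (DT ∩ (CoT ∩ IT)) := by
          rw [div_mul_eq_mul_div, div_le_iff₀ hDpos]
          linarith [B]

/-- **Steps 1–2 for one relay `t ≠ c`.**  `μ(t isolated, t ↔ o, c heavy) ≤ ψ_t · Σ_{T ∋ t heavy, T ⊆ A ∖ c} μ(T is a block)`,
under the champion hypothesis for the pair `(t, c)`. [folklore] -/
theorem per_relay (w : Sym2 (Fin n) → unitInterval) (A : Finset (Fin n)) (o : Fin n) {t c : Fin n} (j : ℕ)
    (htA : t ∈ A) (hc : c ∈ A.erase t)
    (hle : (prodBernoulli w).real {ω : BondConfig (Fin n) | (A.filter fun z => ω ∈ openConn t z).card ≤ j} ≤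
      (prodBernoulli w).real {ω : BondConfig (Fin n) | (A.filter fun z => ω ∈ openConn c z).card ≤ j}) :
    (prodBernoulli w).real ({ω : BondConfig (Fin n) | ∀ s ∈ ({t} : Finset (Fin n)), ∀ x ∈ A.erase t,
        ¬ (openGraph ω).Reachable s x} ∩ ((⋃ s ∈ ({t} : Finset (Fin n)), (openConn s o : Set (BondConfig (Fin n)))) ∩
          {ω : BondConfig (Fin n) | j < (A.filter fun z => ω ∈ openConn c z).card})) ≤
      (prodBernoulli w).real ({ω : BondConfig (Fin n) | ∀ x ∈ A.erase t, ¬ (openGraph ω).Reachable t x} ∩ openConn t o) /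
          (prodBernoulli w).real {ω : BondConfig (Fin n) | ∀ x ∈ A.erase t, ¬ (openGraph ω).Reachable t x} *
        ∑ T ∈ ((A.erase c).powerset.filter fun T => j < T.card).filter (fun T => t ∈ T),
          (prodBernoulli w).real {ω : BondConfig (Fin n) | ∀ s ∈ T, (A.filter fun z => ω ∈ openConn s z) = T} := by
  set μ := prodBernoulli w with hμ
  have S1 := isolated_conn_heavy w A t o c j hc
  set D : Set (BondConfig (Fin n)) :=
    {ω : BondConfig (Fin n) | ∀ s ∈ ({t} : Finset (Fin n)), ∀ x ∈ A.erase t, ¬ (openGraph ω).Reachable s x} with hD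
  set D' : Set (BondConfig (Fin n)) := {ω : BondConfig (Fin n) | ∀ x ∈ A.erase t, ¬ (openGraph ω).Reachable t x} with hD'
  set Co : Set (BondConfig (Fin n)) := ⋃ s ∈ ({t} : Finset (Fin n)), (openConn s o : Set (BondConfig (Fin n))) with hCo
  set Hc : Set (BondConfig (Fin n)) := {ω : BondConfig (Fin n) | j < (A.filter fun z => ω ∈ openConn c z).card} with hHc
  set Ht : Set (BondConfig (Fin n)) := {ω : BondConfig (Fin n) | j < (A.filter fun z => ω ∈ openConn t z).card} with hHt
  have hDD' : D = D' := by
    ext ω; simp only [hD, hD', Set.mem_setOf_eq, Finset.mem_singleton, forall_eq]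
  have hCo' : Co = (openConn t o : Set (BondConfig (Fin n))) := by
    rw [hCo]; exact Finset.set_biUnion_singleton t _
  -- (a) the light term is at most ψ_t · μ(D ∩ Hc)
  have hψnn : 0 ≤ μ.real (D' ∩ openConn t o) / μ.real D' := div_nonneg measureReal_nonneg measureReal_nonneg
  have ha : μ.real (D ∩ (Co ∩ Hc)) ≤ μ.real (D' ∩ openConn t o) / μ.real D' * μ.real (D ∩ Hc) := by
    by_cases hD0 : μ.real D = 0
    · have : μ.real (D ∩ (Co ∩ Hc)) = 0 :=
        le_antisymm (le_trans (measureReal_mono Set.inter_subset_left (measure_ne_top _ _)) (le_of_eq hD0)) measureReal_nonneg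
      rw [this]; exact mul_nonneg hψnn measureReal_nonneg
    · have hDpos : 0 < μ.real D := lt_of_le_of_ne measureReal_nonneg (Ne.symm hD0)
      rw [← hDD', ← hCo', div_mul_eq_mul_div, le_div_iff₀ hDpos]
      linarith [S1]
  -- (b) `D ∩ Hc ⊆ {t ↮ c} ∩ Hc`, then the champion hypothesis, then the block decomposition
  have hct : c ≠ t := (Finset.mem_erase.1 hc).1
  have hb1 : μ.real (D ∩ Hc) ≤ μ.real ((openConn t c : Set (BondConfig (Fin n)))ᶜ ∩ Hc) := by
    refine measureReal_mono (fun ω hω => ⟨?_, hω.2⟩) (measure_ne_top _ _)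
    exact hω.1 t (Finset.mem_singleton_self t) c hc
  have hb2 := heavy_transfer w A t c j hle
  have hb3 : μ.real ((openConn t c : Set (BondConfig (Fin n)))ᶜ ∩ Ht) ≤
      ∑ T ∈ ((A.erase c).powerset.filter fun T => j < T.card).filter (fun T => t ∈ T),
        μ.real {ω : BondConfig (Fin n) | ∀ s ∈ T, (A.filter fun z => ω ∈ openConn s z) = T} :=
    le_trans (measureReal_mono (heavy_subset_blocks A htA c j) (measure_ne_top _ _))
      (measureReal_biUnion_finset_le _ _)
  calc μ.real (D ∩ (Co ∩ Hc)) ≤ μ.real (D' ∩ openConn t o) / μ.real D' * μ.real (D ∩ Hc) := ha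
    _ ≤ μ.real (D' ∩ openConn t o) / μ.real D' *
        ∑ T ∈ ((A.erase c).powerset.filter fun T => j < T.card).filter (fun T => t ∈ T),
          μ.real {ω : BondConfig (Fin n) | ∀ s ∈ T, (A.filter fun z => ω ∈ openConn s z) = T} :=
        mul_le_mul_of_nonneg_left (le_trans hb1 (le_trans hb2 hb3)) hψnn

end SingletonPocketPacking

variable {n : ℕ}

open SingletonPocketPacking in
/-- **Singleton-pocket packing (coupling seat, `NoHeavyLowerTail` calculus).**  Bond percolation `μ = prodBernoulli w`
on `Fin n`, relays `A`, level `j ≥ 1`, observer `o`, and a champion `c ∈ A` (`μ(|π(a)| ≤ j) ≤ μ(|π(c)| ≤ j)` for all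
`a ∈ A`).  If all relays are simultaneously separable with positive probability, then

  `μ(|π(o)| = 1, |π(c)| > j) ≤ μ(|π(o)| > j, o ↮ c)`:

an observer whose pocket is a single relay while the champion is heavy is rarer than an observer with a heavy pocket
avoiding the champion.  (`|A| = 2`, hub form: Kozma–Nitzan's Theorem 1.)  Proof: `lonely_subset`, `per_relay` (BHK 1.4 +
the champion hypothesis), the sum swap, `packing` (KN Lemma 2 + BHK 1.3) and `blockConn_subset/disjoint`.
[cite: KozmaNitzan2024, Lemma 2 p. 6, Theorem 1 p. 7; VandenbergHaggstromKahn2005, Thms. 1.3–1.4] -/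
theorem singletonPocket_le_heavy (w : Sym2 (Fin n) → unitInterval) (A : Finset (Fin n)) {j : ℕ} (hj : 1 ≤ j)
    (o : Fin n) {c : Fin n} (hcA : c ∈ A)
    (hchamp : ∀ a ∈ A, (prodBernoulli w).real {ω : BondConfig (Fin n) | (A.filter fun z => ω ∈ openConn a z).card ≤ j} ≤
      (prodBernoulli w).real {ω : BondConfig (Fin n) | (A.filter fun z => ω ∈ openConn c z).card ≤ j})
    (hM : 0 < (prodBernoulli w).real {ω : BondConfig (Fin n) | ∀ k ∈ A, ∀ l ∈ A, k ≠ l → ¬ (openGraph ω).Reachable k l}) :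
    (prodBernoulli w).real {ω : BondConfig (Fin n) | (A.filter fun z => ω ∈ openConn o z).card = 1 ∧
        j < (A.filter fun z => ω ∈ openConn c z).card} ≤
      (prodBernoulli w).real {ω : BondConfig (Fin n) | j < (A.filter fun z => ω ∈ openConn o z).card ∧
        ω ∉ openConn o c} := by
  set μ := prodBernoulli w with hμ
  set 𝒯 : Finset (Finset (Fin n)) := (A.erase c).powerset.filter fun T => j < T.card with h𝒯
  -- abbreviations for the recurring functions of `t` and `T`
  set ψ : Fin n → ℝ := fun t =>
    μ.real ({ω : BondConfig (Fin n) | ∀ x ∈ A.erase t, ¬ (openGraph ω).Reachable t x} ∩ openConn t o) /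
      μ.real {ω : BondConfig (Fin n) | ∀ x ∈ A.erase t, ¬ (openGraph ω).Reachable t x} with hψ
  set blk : Finset (Fin n) → Set (BondConfig (Fin n)) := fun T =>
    {ω : BondConfig (Fin n) | ∀ s ∈ T, (A.filter fun z => ω ∈ openConn s z) = T} with hblk
  set G : Finset (Fin n) → Set (BondConfig (Fin n)) := fun T =>
    blk T ∩ ⋃ s ∈ T, (openConn s o : Set (BondConfig (Fin n))) with hG
  set light : Fin n → Set (BondConfig (Fin n)) := fun t =>
    {ω : BondConfig (Fin n) | ∀ s ∈ ({t} : Finset (Fin n)), ∀ x ∈ A.erase t, ¬ (openGraph ω).Reachable s x} ∩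
      ((⋃ s ∈ ({t} : Finset (Fin n)), (openConn s o : Set (BondConfig (Fin n)))) ∩
        {ω : BondConfig (Fin n) | j < (A.filter fun z => ω ∈ openConn c z).card}) with hlight
  -- Step 0
  have h0 : μ.real {ω : BondConfig (Fin n) | (A.filter fun z => ω ∈ openConn o z).card = 1 ∧
      j < (A.filter fun z => ω ∈ openConn c z).card} ≤ ∑ t ∈ A.erase c, μ.real (light t) :=
    le_trans (measureReal_mono (lonely_subset A o c hj) (measure_ne_top _ _)) (measureReal_biUnion_finset_le _ _)
  -- Steps 1–2
  have h12 : ∑ t ∈ A.erase c, μ.real (light t) ≤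
      ∑ t ∈ A.erase c, ψ t * ∑ T ∈ 𝒯.filter (fun T => t ∈ T), μ.real (blk T) := by
    refine Finset.sum_le_sum fun t ht => ?_
    have htA : t ∈ A := Finset.mem_of_mem_erase ht
    have hc : c ∈ A.erase t := Finset.mem_erase.2 ⟨fun h => (Finset.mem_erase.1 ht).1 h.symm, hcA⟩
    exact per_relay w A o j htA hc (hchamp t htA)
  -- the sum swap
  have hswap : ∑ t ∈ A.erase c, ψ t * ∑ T ∈ 𝒯.filter (fun T => t ∈ T), μ.real (blk T) =
      ∑ T ∈ 𝒯, (∑ t ∈ T, ψ t) * μ.real (blk T) := by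
    have e1 : ∀ t ∈ A.erase c, ψ t * ∑ T ∈ 𝒯.filter (fun T => t ∈ T), μ.real (blk T) =
        ∑ T ∈ 𝒯, if t ∈ T then ψ t * μ.real (blk T) else 0 := by
      intro t _
      rw [Finset.mul_sum, Finset.sum_filter]
    rw [Finset.sum_congr rfl e1, Finset.sum_comm]
    refine Finset.sum_congr rfl fun T hT => ?_
    have hTsub : T ⊆ A.erase c := by
      rw [h𝒯, Finset.mem_filter, Finset.mem_powerset] at hT; exact hT.1
    rw [← Finset.sum_filter, Finset.filter_mem_eq_inter, Finset.inter_eq_right.2 hTsub, Finset.sum_mul]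
  -- Step 3
  have h3 : ∑ T ∈ 𝒯, (∑ t ∈ T, ψ t) * μ.real (blk T) ≤ ∑ T ∈ 𝒯, μ.real (G T) := by
    refine Finset.sum_le_sum fun T hT => ?_
    have hTsub : T ⊆ A.erase c := by
      rw [h𝒯, Finset.mem_filter, Finset.mem_powerset] at hT; exact hT.1
    have hTA : T ⊆ A := fun x hx => Finset.mem_of_mem_erase (hTsub hx)
    have hMT : 0 < μ.real {ω : BondConfig (Fin n) | ∀ k ∈ T, ∀ l ∈ A, k ≠ l → ¬ (openGraph ω).Reachable k l} :=
      lt_of_lt_of_le hM (measureReal_mono (fun ω hω k hk l hl hkl => hω k (hTA hk) l hl hkl) (measure_ne_top _ _))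
    exact packing w A T o hTA hMT
  -- Step 4
  have h4 : ∑ T ∈ 𝒯, μ.real (G T) ≤ μ.real {ω : BondConfig (Fin n) | j < (A.filter fun z => ω ∈ openConn o z).card ∧
      ω ∉ openConn o c} := by
    rw [← measureReal_biUnion_finset (blockConn_disjoint A o 𝒯) (fun T _ => MeasurableSet.of_discrete)]
    refine measureReal_mono ?_ (measure_ne_top _ _)
    exact Set.iUnion₂_subset fun T hT => blockConn_subset A o hcA j hT
  calc μ.real {ω : BondConfig (Fin n) | (A.filter fun z => ω ∈ openConn o z).card = 1 ∧
          j < (A.filter fun z => ω ∈ openConn c z).card}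
        ≤ ∑ t ∈ A.erase c, μ.real (light t) := h0
    _ ≤ ∑ t ∈ A.erase c, ψ t * ∑ T ∈ 𝒯.filter (fun T => t ∈ T), μ.real (blk T) := h12
    _ = ∑ T ∈ 𝒯, (∑ t ∈ T, ψ t) * μ.real (blk T) := hswap
    _ ≤ ∑ T ∈ 𝒯, μ.real (G T) := h3
    _ ≤ μ.real {ω : BondConfig (Fin n) | j < (A.filter fun z => ω ∈ openConn o z).card ∧ ω ∉ openConn o c} := h4


end Summit.CriticalPhenomena.PercolationContinuityZ3.Theorems
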